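import Mathlib.Analysis.InnerProductSpace.PiL2
import Mathlib.LinearAlgebra.Multilinear.Basis
import Mathlib.Topology.Algebra.Module.Multilinear.Basic
import HarnessLib

/-!
# A continuous multilinear form on `(ℝ³)ⁿ` vanishing on all standard-basis tuples vanishes

Stub P2 of line `Sketch` (skeleton v22) for crux `MoebiusLimitExists` (stmt-CriticalPhenomena-1344):
pure-algebra glue.  The standard basis of the configuration space `(ℝ³)ⁿ = Fin n → EuclideanSpace ℝ (Fin 3)`
is `Pi.single i (EuclideanSpace.single a 1)`, `(i, a) ∈ Fin n × Fin 3` (`Pi.basis` of `EuclideanSpace.basisFun`);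
a `k`-multilinear form is determined by its values on tuples of basis vectors (`Module.Basis.ext_multilinear`).
-/

namespace Summit.CriticalPhenomena.Ising3DConformalLimit.MoebiusLimitExistsSketchV22

/-- **STUB P2 `stub_multilinear_eq_zero_of_basis` (S, pure algebra) — a multilinear form vanishing on all tuples of
standard basis vectors vanishes.**  The standard basis of `(ℝ³)ⁿ` is `Pi.single i (EuclideanSpace.single a 1)`,
`(i, a) ∈ Fin n × Fin 3` (`Module.Basis.ext_multilinear` with `Pi.basis` of `EuclideanSpace.basisFun`, applied to
`f.toMultilinearMap` and `0`; `ContinuousMultilinearMap.toMultilinearMap_injective`). [folklore] -/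
theorem stub_multilinear_eq_zero_of_basis : ∀ (n k : ℕ)
    (f : ContinuousMultilinearMap ℝ (fun _ : Fin k => Fin n → EuclideanSpace ℝ (Fin 3)) ℝ),
    (∀ idx : Fin k → Fin n × Fin 3,
      f (fun j => Pi.single (idx j).1 (EuclideanSpace.single (idx j).2 (1:ℝ))) = 0) → f = 0 := by
  -- adapted from Literature/Geometry/Lorentzian/KerrAdmissibleWaveDataEnergy.lean
  -- (`continuousMultilinearMap_eq_zero_of_basis`) and
  -- Literature/MathematicalPhysics/QuantumManyBody/RelativeFisherInformation.lean
  -- (`clm_eq_zero_of_apply_single_eq_zero`)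
  intro n k f h
  apply ContinuousMultilinearMap.toMultilinearMap_injective
  rw [ContinuousMultilinearMap.toMultilinearMap_zero]
  refine Module.Basis.ext_multilinear
    (fun _ : Fin k => Pi.basis fun _ : Fin n => (EuclideanSpace.basisFun (Fin 3) ℝ).toBasis) fun v => ?_
  rw [zero_apply, ContinuousMultilinearMap.coe_coe]
  simpa only [Pi.basis_apply, OrthonormalBasis.coe_toBasis, EuclideanSpace.basisFun_apply] using
    h fun j => ((v j).1, (v j).2)

end Summit.CriticalPhenomena.Ising3DConformalLimit.MoebiusLimitExistsSketchV22
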